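import Summits.QuantumFields.YangMills.Theorems.BalabanUVNodesN15TwoGridDressedDivergenceNoFitFullG
import Summits.QuantumFields.YangMills.Theorems.BalabanUVNodesN15TwoGridDressedJetSupCarrierFullG
import HarnessLib

/-!
# N15 (NE2) — PROGRAMME D «THE DRESSED SOURCE-DIVERGENCE ENTRY OF THE PAIR OF RECORD», part D-F: ★★★ `T4EtaRate.NE2PlusOperator` BY NAME, HYPOTHESIS-FREE, FOR BAŁABAN's FULL LANDAU-GAUGE
# PAIR `(Δ′_a⁻¹, Δ_a⁻¹)` DRESSED BY THE FIRST-ORDER SPECIES ON THE (3.35)-PAIR CARRIER `coeffBgFO` — ENTRIES 0 (VALUE), 1 (DRESSED GRADIENT) AND 2 (DRESSED SOURCE DIVERGENCE)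
# BACKGROUND-LIVE: K-K's packaging with entry 2 := D-E's dressed source divergence of the pair of record

WHO ∕ WHEN.  Cell `pub-ymgap`, seat `pub-ymgap-dag-n15-a` (KNIT-BY-NAME seat of Track-A DAG node N15 = NE2, g26); `--kind proof --supports stmt-QuantumFields-27366 --as helper` (K3⁸;
count-neutral).  One plumbing `def` (`foFamilyDivFG`) + theorems.  Over D-E `…TwoGridDressedDivergenceNoFitFullG` (★★★ `hasMaj_idef_dressedDiv_gOp`), K-J `…TwoGridDressedJetNoFitFullG` (★★
`hasMaj_projO_idef_bgPair_gOp`), K-K `…TwoGridDressedJetSupCarrierFullG` (the pattern), II-E `…TwoGridFirstOrderSupCarrier` (`coeffBgFO`, `reg335_coeffBgFO_iff`, `foPairing`, `foOps`, `foInstanceFG`,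
`foInstanceFG_gf_M`, `osc_rate_le`), M-F (`supT`), part 54 (`hasMaj_twoGridDefect_lap`), part 60 (`hasMaj_rescale`), n15-b (`one_le_pref4`, `fibreOsc_of_fgrad`), g0 `etaRateIneq342_of_hasMaj_rateWeight`,
`T4EtaRateCoeffDefect.fit_blockAvg` BY NAME; nothing in the tree is modified.

WHY ∕ WHAT.  HANDOFF §g25.6 (t3), located: «the dressed DIVERGENCE entry of the pair of record».  Programme D (D-A…D-E) produced it, hypothesis-free, in sup currency; this file is the by-name
packaging.  §27 `foFamilyDivFG a ν κ` = II-E's `foOps` at `(Δ_a⁻¹, Δ′_a⁻¹)` with entry 1 := `𝔇(∇′_νX′(U), ∇_νX(Ū))` (K-J, LIVE), entry 2 := `𝔇(X′(U)∇′*_κ, X(Ū)∇*_κ)` — THE DRESSED SOURCE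
DIVERGENCE of the pair of record (D-E, LIVE), entry 0 = the dressed values (LIVE), entry 3 = M-F's `supT` entry `𝔇(ΔG)` (the pair's own `U ≡ 1` η-defect, U-blind); §28 ★★★
`ne2PlusOperator_dressedDiv_fullG (hLodd) (hL3 : 3 ≤ L) (hL) (ha) (c₃₅) (hc₃₅) (ν κ) : NE2PlusOperator c₃₅ (foInstanceFG d hL) (foFamilyDivFG d hL a ν κ)` — HYPOTHESIS-FREE (`M₅ = 1`,
`a₀ = min(r₀, r₀′)∕c₃₅`, `γ₀ = min(1∕16, 1∕(8(d+1)))`), ★★ `ne2ZeroOperator_dressedDiv_fullG`.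

HONEST FRAMING ∕ LIMITS.  HYBRID family: entries 0, 1 AND 2 carry the configuration genuinely (entry 2 = the new content: the located item (t3) of HANDOFF §g25.6 closed for the operator layer's
source-divergence entry IN THE ABELIANISED SCALAR-MULTIPLIER MODEL of (3.52)'s `V′(A)` with block-averaged coarse partner (C3), flat `∇*_κ` — Bałaban's covariant `D*_{U′}` differs by diagonal ∕
shift dressings, n15-c FILE 33, located); entry 3 is the pair's `U ≡ 1` η-defect (the dressed Laplacian ∕ covariant-Laplacian entry of the pair of record stays located — it is `1 − a•Q*QX + …`
by `Δ_aG = 1` and needs the `Q*Q`-row's two-grid letters).  `U ≡ 1` Landau-gauge pair on the torus family of record, NOT Bałaban's `G(U)` for general `U`; NE2⁺ as printed NOT PRINTED ∕ NOT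
proved; no statement of record touched; N15 NOT discharged; K3⁸ OPEN; counts UNMOVED (typed 28∕28 · discharged 5∕27); one finite torus per index — NOT ℝ⁴ ∕ infinite volume ∕ OS ∕ mass gap ∕
Clay.  ONE declared `set_option maxHeartbeats 1600000 in` on ★★★ (four-entry readout over long operator terms).
-/

noncomputable section

open scoped BigOperators
open Finset

namespace Summit.QuantumFields.YangMills.BalabanUVNodes.N15.TwoGrid

open Literature.MathematicalPhysics.QuantumFieldTheory.Balaban1983to89
open Literature.MathematicalPhysics.QuantumFieldTheory.Balaban1983to89.B11SectG (BlockNorm HasMaj)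
open Literature.MathematicalPhysics.QuantumFieldTheory.Balaban1983to89.T4EtaRate (PairedInstance EtaPairing EtaRateIneq342 NE2PlusOperator NE2ZeroOperator ne2Zero_of_ne2Plus)
open Literature.MathematicalPhysics.QuantumFieldTheory.Balaban1983to89.T4EtaRateDefect (idef rateWeight)
open Literature.MathematicalPhysics.QuantumFieldTheory.Balaban1983to89.T4EtaRateCoeffDefect (pull blockAvg fit_blockAvg)
open Literature.MathematicalPhysics.QuantumFieldTheory.Balaban1983to89.B5Prop11Plancherel (Tor fine unitVec)
open Literature.MathematicalPhysics.QuantumFieldTheory.Balaban1983to89.B5SiteBridgeP12 (MP)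
open Literature.MathematicalPhysics.QuantumFieldTheory.King1986.Torus (blockOf tdistT tdistT_nonneg)
open Literature.MathematicalPhysics.QuantumFieldTheory.Balaban1983to89.B6UnitTorusCarrier (unitTorusGeo)
open Summit.QuantumFields.YangMills.BalabanUVNodes.N15.VectorPiece (blkFine kingPrV blkFine_comp_kingPrV unitTorusGeoS rateWeight_unitTorusGeoS bshiftEquiv bshiftEquiv_apply)
open Summit.QuantumFields.YangMills.BalabanUVNodes.N15.OperatorReadout (opGeo opFamily opGeo_len etaRateIneq342_of_hasMaj_rateWeight)
open Summit.QuantumFields.YangMills.BalabanUVNodes.N15.BackgroundLayer (bgPair projO fineGeo one_le_pref4 abs_le_iSup_abs avg₁ avg₁_zero fgrad fgrad_apply fibreOsc_of_fgrad)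
open Summit.QuantumFields.YangMills.BalabanUVNodes.N15.GenuineRecord (TGIndexS tgIndexS_cofinal)

variable {d : ℕ}

/-! ## §27 The family with the dressed source divergence of the pair of record live -/

section Sized

variable (d) {L : ℕ} [NeZero L]

/-- THE KERNEL FAMILY at a sized index: II-E's `foOps` at Bałaban's `G := Δ_a⁻¹`, `G′ := Δ′_a⁻¹` with ENTRY 1 := THE DRESSED GRADIENT `𝔇(∇′_νX′(U), ∇_νX(Ū))` (K-J — LIVE), ENTRY 2 := THE DRESSED
SOURCE DIVERGENCE `𝔇(X′(U)∇′*_κ, X(Ū)∇*_κ)` (D-E — LIVE), entry 3 := M-F's `supT` entry 2 (`𝔇(ΔG)`, U-blind), read through `opFamily`.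
[cite: Balaban1985BackgroundPropagators, (3.42) p.397 (the four entries: shape), (3.52) p.400, (3.62)–(3.65) pp.402–403 (mechanism)] -/
def foFamilyDivFG (hL : Odd L ∧ 1 < L) (a : ℝ) (ν κ : Fin (d + 1)) (j : TGIndexS) : B9.KernelFamily (foInstanceFG d hL j).gc (foInstanceFG d hL j).Bf :=
  show B9.KernelFamily (opGeo (unitTorusGeoS L j.k (TGIndex.Mn d hL j.toTGIndex) j.Msz) (Tor (fine (L ^ j.k) (TGIndex.Mn d hL j.toTGIndex)) × Fin (d + 1))
      (blkFine L j.k (TGIndex.Mn d hL j.toTGIndex))) (coeffBgFO (TGIndex.Mn d hL j.toTGIndex) (L ^ j.m * L ^ j.k) j.Msz) from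
    opFamily (g := unitTorusGeoS L j.k (TGIndex.Mn d hL j.toTGIndex) j.Msz) (B := coeffBgFO (TGIndex.Mn d hL j.toTGIndex) (L ^ j.m * L ^ j.k) j.Msz)
      (blkFine L j.k (TGIndex.Mn d hL j.toTGIndex)) (blkFine L j.k (TGIndex.Mn d hL j.toTGIndex) ∘ kingPrV L j.k j.m (TGIndex.Mn d hL j.toTGIndex))
      (foOps (TGIndex.Mn d hL j.toTGIndex) j.k j.m j.Msz (gOp (TGIndex.Mn d hL j.toTGIndex) (L ^ j.k) a) (gOp (TGIndex.Mn d hL j.toTGIndex) (L ^ j.m * L ^ j.k) a)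
        fun n U => ![
          idef (pull (kingPrV L j.k j.m (TGIndex.Mn d hL j.toTGIndex))) (pull (kingPrV L j.k j.m (TGIndex.Mn d hL j.toTGIndex)))
            (projO (some ν) ∘ₗ bgPair (gOp (TGIndex.Mn d hL j.toTGIndex) (L ^ j.m * L ^ j.k) a)
              (fun μ' => symbOp (TGIndex.Mn d hL j.toTGIndex) (L ^ j.m * L ^ j.k) (sD (TGIndex.Mn d hL j.toTGIndex) (L ^ j.m * L ^ j.k) μ' ((L ^ j.m * L ^ j.k : ℕ) : ℝ)) ∘ₗ
                gOp (TGIndex.Mn d hL j.toTGIndex) (L ^ j.m * L ^ j.k) a) U.1 U.2)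
            (projO (some ν) ∘ₗ bgPair (gOp (TGIndex.Mn d hL j.toTGIndex) (L ^ j.k) a)
              (fun μ' => symbOp (TGIndex.Mn d hL j.toTGIndex) (L ^ j.k) (sD (TGIndex.Mn d hL j.toTGIndex) (L ^ j.k) μ' ((L ^ j.k : ℕ) : ℝ)) ∘ₗ gOp (TGIndex.Mn d hL j.toTGIndex) (L ^ j.k) a)
              (blockAvg (kingPrV L j.k j.m (TGIndex.Mn d hL j.toTGIndex)) U.1) (fun μ' => blockAvg (kingPrV L j.k j.m (TGIndex.Mn d hL j.toTGIndex)) (U.2 μ'))),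
          idef (pull (kingPrV L j.k j.m (TGIndex.Mn d hL j.toTGIndex))) (pull (kingPrV L j.k j.m (TGIndex.Mn d hL j.toTGIndex)))
            ((projO none ∘ₗ bgPair (gOp (TGIndex.Mn d hL j.toTGIndex) (L ^ j.m * L ^ j.k) a)
              (fun μ' => symbOp (TGIndex.Mn d hL j.toTGIndex) (L ^ j.m * L ^ j.k) (sD (TGIndex.Mn d hL j.toTGIndex) (L ^ j.m * L ^ j.k) μ' ((L ^ j.m * L ^ j.k : ℕ) : ℝ)) ∘ₗ
                gOp (TGIndex.Mn d hL j.toTGIndex) (L ^ j.m * L ^ j.k) a) U.1 U.2) ∘ₗ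
              symbOp (TGIndex.Mn d hL j.toTGIndex) (L ^ j.m * L ^ j.k) (((L ^ j.m * L ^ j.k : ℕ) : ℝ) • (sTinv (TGIndex.Mn d hL j.toTGIndex) (L ^ j.m * L ^ j.k) κ - 1)))
            ((projO none ∘ₗ bgPair (gOp (TGIndex.Mn d hL j.toTGIndex) (L ^ j.k) a)
              (fun μ' => symbOp (TGIndex.Mn d hL j.toTGIndex) (L ^ j.k) (sD (TGIndex.Mn d hL j.toTGIndex) (L ^ j.k) μ' ((L ^ j.k : ℕ) : ℝ)) ∘ₗ gOp (TGIndex.Mn d hL j.toTGIndex) (L ^ j.k) a)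
              (blockAvg (kingPrV L j.k j.m (TGIndex.Mn d hL j.toTGIndex)) U.1) (fun μ' => blockAvg (kingPrV L j.k j.m (TGIndex.Mn d hL j.toTGIndex)) (U.2 μ'))) ∘ₗ
              symbOp (TGIndex.Mn d hL j.toTGIndex) (L ^ j.k) (((L ^ j.k : ℕ) : ℝ) • (sTinv (TGIndex.Mn d hL j.toTGIndex) (L ^ j.k) κ - 1))),
          supT d hL a ν κ j 2 U.1] n)

end Sized

/-! ## §28 ★★★ `NE2PlusOperator` BY NAME, entries 0, 1 and 2 background-live, hypothesis-free, pair of record -/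

section Main

variable (d) {L : ℕ} [NeZero L]

set_option maxHeartbeats 1600000 in
/-- ★★★ **NE2⁺, OPERATOR LAYER — `T4EtaRate.NE2PlusOperator` BY NAME, HYPOTHESIS-FREE, FOR BAŁABAN's FULL PAIR DRESSED BY THE FIRST-ORDER SPECIES ON THE (3.35)-PAIR CARRIER, WITH THE VALUE, THE
GRADIENT AND THE SOURCE-DIVERGENCE ENTRIES BACKGROUND-LIVE.**  For odd `L ≥ 3`, `a > 0`, `c₃₅ > 0`, directions `ν, κ`: `NE2PlusOperator c₃₅ (foInstanceFG d hL) (foFamilyDivFG d hL a ν κ)`.  (3.35) is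
consumed as the sups of `c′`, `a′_μ` and of the first quotients of `a′` — NOTHING on `∇c′`, NOTHING on `∇∇a′`; entries 0–1 = K-J ★★ (fit of `a′` derived), entry 2 = D-E ★★★, entry 3 = M-F's
`U ≡ 1` η-defect; `γ₀ = min(1∕16, 1∕(8(d+1)))`. [cite: Balaban1985BackgroundPropagators, Thm 3.1 p.397 (quantifier template), (3.35) p.396, (3.42) p.397, (3.52) p.400, (3.62)–(3.65) pp.402–403 (shapes,
mechanism); Balaban1984PropagatorsI, Prop. 1.2 (1.110)–(1.111) p.35; King1986, Prop. 3.9 (3.73) p.665 (rate factor)] -/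
theorem ne2PlusOperator_dressedDiv_fullG (hLodd : Odd L) (hL3 : 3 ≤ L) (hL : Odd L ∧ 1 < L) {a : ℝ} (ha : 0 < a) (c35 : ℝ) (hc35 : 0 < c35) (ν κ : Fin (d + 1)) :
    NE2PlusOperator c35 (foInstanceFG d hL) (foFamilyDivFG d hL a ν κ) := by
  have hL2 : 2 ≤ L := by omega
  have hL1 : (1 : ℝ) ≤ (L : ℝ) := by exact_mod_cast (show 1 ≤ L by omega)
  have hLr : (0 : ℝ) < (L : ℝ) := by positivity
  set γ₀ : ℝ := min (1 / 16) (1 / (8 * ((d : ℝ) + 1))) with hγ₀def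
  have hd8 : (0 : ℝ) < 1 / (8 * ((d : ℝ) + 1)) := by positivity
  have hγ₀ : 0 < γ₀ := lt_min (by norm_num) hd8
  have hγ₀le : γ₀ ≤ 1 / 16 := min_le_left _ _
  have hγ₀le' : γ₀ ≤ 1 / (8 * ((d : ℝ) + 1)) := min_le_right _ _
  -- entries 0–1: K-J; entry 2: D-E; entry 3: the `U ≡ 1` Laplacian η-defect of record
  obtain ⟨δE, r₀, B, hδE, hr₀, hB, HJ⟩ := hasMaj_projO_idef_bgPair_gOp d hLodd hL3 ha
  obtain ⟨δD, r₁, BD, hδD, hr₁, hBD, HD⟩ := hasMaj_idef_dressedDiv_gOp d hLodd hL3 ha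
  obtain ⟨δ₄, C₃', hδ₄, hC₃', H3⟩ := hasMaj_twoGridDefect_lap (d := d) hLodd hL2 ha (γ := 2 * γ₀) (by positivity) (by
    have : 2 * γ₀ ≤ 2 * (1 / 16) := by linarith
    linarith)
  set rm : ℝ := min r₀ r₁ with hrm_def
  have hrm : 0 < rm := lt_min hr₀ hr₁
  have hrm₀ : rm ≤ r₀ := min_le_left _ _
  have hrm₁ : rm ≤ r₁ := min_le_right _ _
  set δ₀ : ℝ := min (min δE δD) δ₄ with hδ₀def
  have hδ₀ : 0 < δ₀ := lt_min (lt_min hδE hδD) hδ₄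
  set BJ : ℝ := B * (1 + r₀ + 2 * ((d : ℝ) + 1) * r₀) with hBJdef
  have hBJ : 0 < BJ := by positivity
  set B₀ : ℝ := max (max BJ BD) C₃' with hB₀def
  have hB₀ : 0 < B₀ := hBJ.trans_le ((le_max_left _ _).trans (le_max_left _ _))
  refine ⟨1, δ₀, rm / c35, B₀, γ₀, one_pos, hδ₀, by positivity, hB₀, hγ₀, fun j _hM α₀ hα₀ hMα U hU => ?_⟩
  -- at the index `j`: the letters of the configuration
  obtain ⟨hU1, hU2, hU3⟩ := (reg335_coeffBgFO_iff (TGIndex.Mn d hL j.toTGIndex) (L ^ j.m * L ^ j.k) j.Msz c35 α₀ U).1 hU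
  have hMsz : (0 : ℝ) ≤ j.Msz := zero_le_one.trans j.one_le_Msz
  have hr0 : 0 ≤ c35 * j.Msz * α₀ := by positivity
  have hrrm : c35 * j.Msz * α₀ ≤ rm := by
    have h := mul_le_mul_of_nonneg_left hMα hc35.le
    rw [foInstanceFG_gf_M, mul_div_cancel₀ _ hc35.ne'] at h
    linarith [h]
  have hrr₀ : c35 * j.Msz * α₀ ≤ r₀ := hrrm.trans hrm₀
  have hrr₁ : c35 * j.Msz * α₀ ≤ r₁ := hrrm.trans hrm₁
  have hn' : (0 : ℝ) < ((L ^ j.m * L ^ j.k : ℕ) : ℝ) := by positivity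
  have hfa : ∀ μ' z, |U.2 μ' z - blockAvg (kingPrV L j.k j.m (TGIndex.Mn d hL j.toTGIndex)) (U.2 μ') (kingPrV L j.k j.m (TGIndex.Mn d hL j.toTGIndex) z)| ≤
      ((2 * ((d + 1) * (L ^ j.m - 1)) : ℕ) : ℝ) * (c35 * j.Msz * α₀ / ((L ^ j.m * L ^ j.k : ℕ) : ℝ)) :=
    fun μ' z => fit_blockAvg _ (fibreOsc_of_fgrad L j.k j.m (TGIndex.Mn d hL j.toTGIndex) hn' fun κ' z => hU3 μ' κ' z) z
  have hoa : 0 ≤ ((2 * ((d + 1) * (L ^ j.m - 1)) : ℕ) : ℝ) * (c35 * j.Msz * α₀ / ((L ^ j.m * L ^ j.k : ℕ) : ℝ)) := by positivity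
  have hJ := HJ j.mT j.k j.m j.one_le hL _ hr0 hrr₀ _ hoa U.1 U.2 hU1 hU2 hfa
  have hDiv := HD j.mT j.k j.m j.one_le hL κ _ hr0 hrr₁ U.1 U.2 hU1 hU2 hU3
  -- the readout
  have hη : 0 < (unitTorusGeoS L j.k (TGIndex.Mn d hL j.toTGIndex) j.Msz).eta := inv_pos.mpr (pow_pos hLr _)
  have hblk : blkFine L j.k (TGIndex.Mn d hL j.toTGIndex) ∘ kingPrV L j.k j.m (TGIndex.Mn d hL j.toTGIndex) =
      fun i : Tor (fine (L ^ j.m * L ^ j.k) (TGIndex.Mn d hL j.toTGIndex)) × Fin (d + 1) => blockOf (L ^ j.m * L ^ j.k) (TGIndex.Mn d hL j.toTGIndex) i.1 :=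
    blkFine_comp_kingPrV (TGIndex.Mn d hL j.toTGIndex) L j.k j.m
  unfold foFamilyDivFG
  rw [hblk]
  have hrw : ∀ y' : Tor (TGIndex.Mn d hL j.toTGIndex), rateWeight (unitTorusGeoS L j.k (TGIndex.Mn d hL j.toTGIndex) j.Msz) γ₀ y' = ((L : ℝ) ^ j.k) ^ (-γ₀) :=
    fun y' => rateWeight_unitTorusGeoS L (TGIndex.Mn d hL j.toTGIndex) j.k j.Msz γ₀ y'
  have hcast : ((L ^ j.k : ℕ) : ℝ) = (L : ℝ) ^ j.k := by push_cast; ring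
  have hx1 : (1 : ℝ) ≤ (L : ℝ) ^ j.k := one_le_pow₀ hL1
  -- absorptions: `(L^k)^{−1∕16}, (L^k)^{−1∕(8(d+1))} ≤ (L^k)^{−γ₀}`, `r ≤ r₀`, the derived fit `≤ 2(d+1)r₀(L^k)^{−γ₀}`
  have h16 : ((L ^ j.k : ℕ) : ℝ) ^ (-(1 / 16 : ℝ)) ≤ ((L : ℝ) ^ j.k) ^ (-γ₀) := by rw [hcast]; exact Real.rpow_le_rpow_of_exponent_le hx1 (by linarith)
  have h8 : ((L ^ j.k : ℕ) : ℝ) ^ (-(1 / (8 * ((d : ℝ) + 1)))) ≤ ((L : ℝ) ^ j.k) ^ (-γ₀) := by rw [hcast]; exact Real.rpow_le_rpow_of_exponent_le hx1 (by linarith)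
  have hθeq : ((L ^ j.k : ℕ) : ℝ) ^ (-(min (1 / 16 : ℝ) (1 / (8 * ((d : ℝ) + 1))))) = ((L : ℝ) ^ j.k) ^ (-γ₀) := by rw [hcast]
  have hθ : 0 ≤ ((L : ℝ) ^ j.k) ^ (-γ₀) := Real.rpow_nonneg (pow_nonneg hLr.le _) _
  have hosc := osc_rate_le (d := d) j.k j.m hL1 (γ := γ₀) hr0 hrr₀ (by linarith)
  have hsum : ((L ^ j.k : ℕ) : ℝ) ^ (-(1 / 16 : ℝ)) + (c35 * j.Msz * α₀) * ((L ^ j.k : ℕ) : ℝ) ^ (-(1 / (8 * ((d : ℝ) + 1)))) +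
      ((2 * ((d + 1) * (L ^ j.m - 1)) : ℕ) : ℝ) * (c35 * j.Msz * α₀ / ((L ^ j.m * L ^ j.k : ℕ) : ℝ)) ≤ (1 + r₀ + 2 * ((d : ℝ) + 1) * r₀) * ((L : ℝ) ^ j.k) ^ (-γ₀) := by
    have hmid : (c35 * j.Msz * α₀) * ((L ^ j.k : ℕ) : ℝ) ^ (-(1 / (8 * ((d : ℝ) + 1)))) ≤ r₀ * ((L : ℝ) ^ j.k) ^ (-γ₀) :=
      mul_le_mul hrr₀ h8 (Real.rpow_nonneg (by positivity) _) hr₀.le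
    linarith [hosc, hmid, h16]
  have hexp : ∀ {t : ℝ} (y y' : Tor (TGIndex.Mn d hL j.toTGIndex)), δ₀ ≤ t →
      Real.exp (-(t * tdistT (TGIndex.Mn d hL j.toTGIndex) y y')) ≤ Real.exp (-(δ₀ * tdistT (TGIndex.Mn d hL j.toTGIndex) y y')) :=
    fun y y' ht => Real.exp_le_exp.mpr (by nlinarith [tdistT_nonneg (TGIndex.Mn d hL j.toTGIndex) y y'])
  have hδ₀E : δ₀ ≤ δE := (min_le_left _ _).trans (min_le_left _ _)
  have hδ₀D : δ₀ ≤ δD := (min_le_left _ _).trans (min_le_right _ _)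
  have hδ₀4 : δ₀ ≤ δ₄ := min_le_right _ _
  have hjet : ∀ jj : Option (Fin (d + 1)), HasMaj (BlockNorm.ofBlocks (unitTorusGeoS L j.k (TGIndex.Mn d hL j.toTGIndex) j.Msz) (blkFine L j.k (TGIndex.Mn d hL j.toTGIndex)))
      (BlockNorm.ofBlocks (unitTorusGeoS L j.k (TGIndex.Mn d hL j.toTGIndex) j.Msz) (fun i : Tor (fine (L ^ j.m * L ^ j.k) (TGIndex.Mn d hL j.toTGIndex)) × Fin (d + 1) => blockOf (L ^ j.m * L ^ j.k) (TGIndex.Mn d hL j.toTGIndex) i.1))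
      (idef (pull (kingPrV L j.k j.m (TGIndex.Mn d hL j.toTGIndex))) (pull (kingPrV L j.k j.m (TGIndex.Mn d hL j.toTGIndex)))
        (projO jj ∘ₗ bgPair (gOp (TGIndex.Mn d hL j.toTGIndex) (L ^ j.m * L ^ j.k) a)
          (fun μ' => symbOp (TGIndex.Mn d hL j.toTGIndex) (L ^ j.m * L ^ j.k) (sD (TGIndex.Mn d hL j.toTGIndex) (L ^ j.m * L ^ j.k) μ' ((L ^ j.m * L ^ j.k : ℕ) : ℝ)) ∘ₗ
            gOp (TGIndex.Mn d hL j.toTGIndex) (L ^ j.m * L ^ j.k) a) U.1 U.2)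
        (projO jj ∘ₗ bgPair (gOp (TGIndex.Mn d hL j.toTGIndex) (L ^ j.k) a)
          (fun μ' => symbOp (TGIndex.Mn d hL j.toTGIndex) (L ^ j.k) (sD (TGIndex.Mn d hL j.toTGIndex) (L ^ j.k) μ' ((L ^ j.k : ℕ) : ℝ)) ∘ₗ gOp (TGIndex.Mn d hL j.toTGIndex) (L ^ j.k) a)
          (blockAvg (kingPrV L j.k j.m (TGIndex.Mn d hL j.toTGIndex)) U.1) (fun μ' => blockAvg (kingPrV L j.k j.m (TGIndex.Mn d hL j.toTGIndex)) (U.2 μ'))))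
      (fun y y' => BJ * Real.exp (-(δ₀ * tdistT (TGIndex.Mn d hL j.toTGIndex) y y')) * rateWeight (unitTorusGeoS L j.k (TGIndex.Mn d hL j.toTGIndex) j.Msz) γ₀ y') := fun jj => by
    refine (hJ jj).mono fun y y' => ?_
    rw [hrw]
    have hE := Real.exp_nonneg (-(δE * tdistT (TGIndex.Mn d hL j.toTGIndex) y y'))
    calc B * (((L ^ j.k : ℕ) : ℝ) ^ (-(1 / 16 : ℝ)) + c35 * j.Msz * α₀ * ((L ^ j.k : ℕ) : ℝ) ^ (-(1 / (8 * ((d : ℝ) + 1)))) +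
            ((2 * ((d + 1) * (L ^ j.m - 1)) : ℕ) : ℝ) * (c35 * j.Msz * α₀ / ((L ^ j.m * L ^ j.k : ℕ) : ℝ))) * Real.exp (-(δE * tdistT (TGIndex.Mn d hL j.toTGIndex) y y'))
        ≤ B * ((1 + r₀ + 2 * ((d : ℝ) + 1) * r₀) * ((L : ℝ) ^ j.k) ^ (-γ₀)) * Real.exp (-(δ₀ * tdistT (TGIndex.Mn d hL j.toTGIndex) y y')) :=
          mul_le_mul (mul_le_mul_of_nonneg_left hsum hB.le) (hexp y y' hδ₀E) hE (by positivity)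
      _ = BJ * Real.exp (-(δ₀ * tdistT (TGIndex.Mn d hL j.toTGIndex) y y')) * ((L : ℝ) ^ j.k) ^ (-γ₀) := by rw [hBJdef]; ring
  refine etaRateIneq342_of_hasMaj_rateWeight (g := unitTorusGeoS L j.k (TGIndex.Mn d hL j.toTGIndex) j.Msz) (B := coeffBgFO (TGIndex.Mn d hL j.toTGIndex) (L ^ j.m * L ^ j.k) j.Msz)
    (blkFine L j.k (TGIndex.Mn d hL j.toTGIndex)) (fun i : Tor (fine (L ^ j.m * L ^ j.k) (TGIndex.Mn d hL j.toTGIndex)) × Fin (d + 1) => blockOf (L ^ j.m * L ^ j.k) (TGIndex.Mn d hL j.toTGIndex) i.1)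
    hη hLr hB₀.le (c := ![BJ, BJ, BD, C₃']) (fun n => by fin_cases n <;> simp <;> positivity) (fun n y => ?_) _ U fun n => ?_
  · -- `c n ≤ B₀ ≤ B₀·pref4`
    have hlen : 1 ≤ (unitTorusGeoS L j.k (TGIndex.Mn d hL j.toTGIndex) j.Msz).len y := by
      show (1 : ℝ) ≤ (L : ℝ) ^ j.k * (((L : ℝ) ^ j.k)⁻¹)
      rw [mul_inv_cancel₀ (pow_ne_zero _ hLr.ne')]
    have hpref := one_le_pref4 hlen n
    have hcn : (![BJ, BJ, BD, C₃'] : Fin 4 → ℝ) n ≤ B₀ := by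
      fin_cases n
      · exact (le_max_left _ _).trans (le_max_left _ _)
      · exact (le_max_left _ _).trans (le_max_left _ _)
      · exact (le_max_right _ _).trans (le_max_left _ _)
      · exact le_max_right _ _
    calc _ ≤ B₀ := hcn
      _ = B₀ * 1 := (mul_one _).symm
      _ ≤ _ := mul_le_mul_of_nonneg_left hpref hB₀.le
  · fin_cases n
    · exact hjet none
    · exact hjet (some ν)
    · -- entry 2: the dressed source divergence (D-E)
      refine hDiv.mono fun y y' => ?_
      rw [hrw, hθeq]
      have hE := Real.exp_nonneg (-(δD * tdistT (TGIndex.Mn d hL j.toTGIndex) y y'))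
      calc BD * ((L : ℝ) ^ j.k) ^ (-γ₀) * Real.exp (-(δD * tdistT (TGIndex.Mn d hL j.toTGIndex) y y'))
          ≤ BD * ((L : ℝ) ^ j.k) ^ (-γ₀) * Real.exp (-(δ₀ * tdistT (TGIndex.Mn d hL j.toTGIndex) y y')) := mul_le_mul_of_nonneg_left (hexp y y' hδ₀D) (by positivity)
        _ = _ := by simp; ring
    · have hγ₃ : γ₀ ≤ 2 * γ₀ / 2 := by linarith
      have e3 := (H3 j.mT j.k j.m j.one_le hL).mono
        (K' := fun y y' => C₃' * ((L : ℝ) ^ j.k) ^ (-(2 * γ₀ / 2)) * Real.exp (-(δ₄ * tdistT (MP (paramsOf d L j.mT j.k hL)) y y'))) fun y y' => by rw [hcast]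
      have e := hasMaj_rescale hL1 hC₃'.le (le_refl C₃') hγ₃ hδ₀4 e3
      exact e.mono fun y y' => le_of_eq (by rw [hrw]; simp; ring)

/-- ★★ **NE2⁰ FOR THE SAME FAMILY — `T4EtaRate.NE2ZeroOperator` BY NAME**: the trivial family `U = 0` is regular for every `α₀ > 0` under the guard, so `ne2Zero_of_ne2Plus` applies.
[cite: Balaban1985BackgroundPropagators, Thm 3.1 p.397 (quantifier template); King1986, Props. 3.8–3.9 (3.71)–(3.75) pp.664–665 (rate shape)] -/
theorem ne2ZeroOperator_dressedDiv_fullG (hLodd : Odd L) (hL3 : 3 ≤ L) (hL : Odd L ∧ 1 < L) {a : ℝ} (ha : 0 < a) {c35 : ℝ} (hc35 : 0 < c35) (ν κ : Fin (d + 1)) :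
    NE2ZeroOperator (foInstanceFG d hL) (foFamilyDivFG d hL a ν κ) := by
  refine ne2Zero_of_ne2Plus (c35 := c35) (fun j α₀ hα₀ => ?_) (ne2PlusOperator_dressedDiv_fullG d hLodd hL3 hL ha c35 hc35 ν κ)
  have hM : (0 : ℝ) ≤ j.Msz := zero_le_one.trans j.one_le_Msz
  have h0 : (0 : ℝ) ≤ c35 * j.Msz * α₀ := by positivity
  refine (reg335_coeffBgFO_iff (TGIndex.Mn d hL j.toTGIndex) (L ^ j.m * L ^ j.k) j.Msz c35 α₀ _).2 ⟨fun z => ?_, fun μ' z => ?_, fun μ' κ' z => ?_⟩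
  · show |(0 : ℝ)| ≤ _; rw [abs_zero]; exact h0
  · show |(0 : ℝ)| ≤ _; rw [abs_zero]; exact h0
  · rw [fgrad_apply]
    show |((L ^ j.m * L ^ j.k : ℕ) : ℝ) * ((0 : ℝ) - 0)| ≤ _
    rw [sub_zero, mul_zero, abs_zero]; exact h0

end Main

end Summit.QuantumFields.YangMills.BalabanUVNodes.N15.TwoGrid

end
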